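import Literature.Computability.Complexity.DegreeReductionSoundness
import Literature.Computability.Complexity.CompleteRotGraphs
import Literature.Computability.Complexity.Expanderize
import HarnessLib

/-!
# One-shot preprocessing of a binary constraint system: regular and `1/2`-expanding, with complete graphs

Topic `Computability/Complexity`, namespaces `Literature.Computability.Complexity.Expander.RotGraph` and
`…Expander.DegreeReduction`.  Arora–Barak's Claims 22.37 (degree reduction by clouds) and 22.38
(expanderizing) performed ONCE, with graphs of polynomial degree in place of constant-degree expanders —
for the tree's one-shot reduction from gap-E3SAT to gap label cover (`GapE3CNFToLabelCover.lean`), whose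
polynomial-time machine must then only do modular arithmetic (`CompleteRotGraphs.lean`):

* `unionC`, `thickC`, `violN`, `violN_union`, `violN_thick` — dart constraints of unions and thickenings
  of regular graphs (`ExpanderOps.lean`) and their violated-dart counts.
* `DegreeReduction.mul_cloudBad_le_card_cloudViol'`, `refined_soundness` — Claim 22.37's analysis
  (`DegreeReductionSoundness.lean`) with the expansion hypothesis required only at the size of each cloud,
  and in the refined form `min(2(T+1), η) · ε m ≤ T · 2#bad + #violated` that accounts for a `T`-fold
  thickened constraint dart.
* `osGraph e`, `osC R` — **one-shot degree reduction**: on the `2m` occurrences, the constraint matching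
  thickened `2m` times, united with the cloud graph whose clouds carry the complete graphs `cc k (2m)`;
  degree `2m + (2m + 1)`; `osC_lift` (completeness), **`os_soundness`**: if every assignment with values
  `< W` violates `≥ ε m` constraints then every assignment with values `< W` violates `≥ (m/2) ε m` darts.
* `exGraph e`, `exC R` — **one-shot expanderization**: `osGraph` thickened `2m` times united with the
  complete graph `cc (2m) (2m)` thickened to the same degree; `exC_lift`, **`ex_soundness`** (violated
  fraction `≥ ε/40` of the `n·d` darts), **`ex_spectral`** (`λ ≤ 1/2`), `ex_hacc`-free (no totality claims).

## References

* S. Arora, B. Barak, *Computational Complexity: A Modern Approach*, CUP 2009, §22.A, Claims 22.37–22.38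
  and their proofs; Exercise 21.7 (λ of a union).
-/

namespace Literature.Computability.Complexity

open Finset Matrix

namespace Expander

namespace RotGraph

variable {n d d₁ d₂ : ℕ}

/-! ### Constraints of unions and thickenings -/

/-- The dart constraints of `G₁ ∪ G₂`: those of `G₁` on the first `d₁` labels, those of `G₂` on the rest. [cite: AroraBarakCC2009, Claim 22.38 (proof)] -/
def unionC (C₁ : Fin n → Fin d₁ → ℕ → ℕ → Bool) (C₂ : Fin n → Fin d₂ → ℕ → ℕ → Bool) :
    Fin n → Fin (d₁ + d₂) → ℕ → ℕ → Bool := fun v i => Fin.addCases (C₁ v) (C₂ v) i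

/-- `unionC` on a label of the first graph. [folklore] -/
@[simp] theorem unionC_castAdd (C₁ : Fin n → Fin d₁ → ℕ → ℕ → Bool) (C₂ : Fin n → Fin d₂ → ℕ → ℕ → Bool) (v : Fin n) (j : Fin d₁) :
    unionC C₁ C₂ v (Fin.castAdd d₂ j) = C₁ v j := by
  simp [unionC]

/-- `unionC` on a label of the second graph. [folklore] -/
@[simp] theorem unionC_natAdd (C₁ : Fin n → Fin d₁ → ℕ → ℕ → Bool) (C₂ : Fin n → Fin d₂ → ℕ → ℕ → Bool) (v : Fin n) (j : Fin d₂) :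
    unionC C₁ C₂ v (Fin.natAdd d₁ j) = C₂ v j := by
  simp [unionC]

/-- The dart constraints of the `c`-fold thickening: every parallel copy carries the constraint of its dart. [cite: AroraBarakCC2009, Claim 22.38 (proof)] -/
def thickC (C : Fin n → Fin d → ℕ → ℕ → Bool) (c : ℕ) : Fin n → Fin (d * c) → ℕ → ℕ → Bool :=
  fun v i => C v (finProdFinEquiv.symm i).1

/-- `thickC` on a decoded label. [folklore] -/
@[simp] theorem thickC_apply (C : Fin n → Fin d → ℕ → ℕ → Bool) (c : ℕ) (v : Fin n) (i : Fin d) (j : Fin c) :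
    thickC C c v (finProdFinEquiv (i, j)) = C v i := by
  simp [thickC]

/-- **The number of darts of `(G, C)` violated by `σ`.** [cite: AroraBarakCC2009, Def. 22.1 (UNSAT fraction of a constraint graph)] -/
def violN (G : RotGraph n d) (C : Fin n → Fin d → ℕ → ℕ → Bool) (σ : Fin n → ℕ) : ℕ :=
  (univ.filter fun x : Fin n × Fin d => C x.1 x.2 (σ x.1) (σ (G.nbr x.1 x.2)) = false).card

/-- `violN` as a double sum of indicators. [folklore] -/
theorem violN_eq_sum (G : RotGraph n d) (C : Fin n → Fin d → ℕ → ℕ → Bool) (σ : Fin n → ℕ) :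
    violN G C σ = ∑ v : Fin n, ∑ i : Fin d, if C v i (σ v) (σ (G.nbr v i)) = false then 1 else 0 := by
  unfold violN
  rw [card_filter, ← univ_product_univ, sum_product]

/-- **Violated darts of a union add up.** [folklore] -/
theorem violN_union (G₁ : RotGraph n d₁) (G₂ : RotGraph n d₂) (C₁ : Fin n → Fin d₁ → ℕ → ℕ → Bool)
    (C₂ : Fin n → Fin d₂ → ℕ → ℕ → Bool) (σ : Fin n → ℕ) :
    violN (G₁.union G₂) (unionC C₁ C₂) σ = violN G₁ C₁ σ + violN G₂ C₂ σ := by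
  rw [violN_eq_sum, violN_eq_sum, violN_eq_sum, ← sum_add_distrib]
  refine sum_congr rfl fun v _ => ?_
  rw [Fin.sum_univ_add]
  simp only [unionC_castAdd, unionC_natAdd, union_nbr_castAdd, union_nbr_natAdd]

/-- **Violated darts of a thickening are multiplied by the thickness.** [folklore] -/
theorem violN_thick (G : RotGraph n d) (C : Fin n → Fin d → ℕ → ℕ → Bool) (c : ℕ) (σ : Fin n → ℕ) :
    violN (G.thick c) (thickC C c) σ = violN G C σ * c := by
  rw [violN_eq_sum, violN_eq_sum, sum_mul]
  refine sum_congr rfl fun v _ => ?_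
  rw [← Equiv.sum_comp finProdFinEquiv, Fintype.sum_prod_type, sum_mul]
  refine sum_congr rfl fun i _ => ?_
  simp only [thickC_apply, thick_nbr, sum_const, card_univ, Fintype.card_fin, smul_eq_mul, mul_comm]

/-- A satisfied union. [folklore] -/
theorem unionC_of_forall {G₁ : RotGraph n d₁} {G₂ : RotGraph n d₂} {C₁ : Fin n → Fin d₁ → ℕ → ℕ → Bool}
    {C₂ : Fin n → Fin d₂ → ℕ → ℕ → Bool} {σ : Fin n → ℕ}
    (h₁ : ∀ v i, C₁ v i (σ v) (σ (G₁.nbr v i)) = true) (h₂ : ∀ v i, C₂ v i (σ v) (σ (G₂.nbr v i)) = true)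
    (v : Fin n) (i : Fin (d₁ + d₂)) : unionC C₁ C₂ v i (σ v) (σ ((G₁.union G₂).nbr v i)) = true := by
  induction i using Fin.addCases with
  | left j => rw [unionC_castAdd, union_nbr_castAdd]; exact h₁ v j
  | right j => rw [unionC_natAdd, union_nbr_natAdd]; exact h₂ v j

/-- A satisfied thickening. [folklore] -/
theorem thickC_of_forall {G : RotGraph n d} {C : Fin n → Fin d → ℕ → ℕ → Bool} {σ : Fin n → ℕ} (c : ℕ)
    (h : ∀ v i, C v i (σ v) (σ (G.nbr v i)) = true) (v : Fin n) (i : Fin (d * c)) :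
    thickC C c v i (σ v) (σ ((G.thick c).nbr v i)) = true := by
  obtain ⟨⟨i, j⟩, rfl⟩ := finProdFinEquiv.surjective i
  rw [thickC_apply, thick_nbr]
  exact h v i

end RotGraph

namespace DegreeReduction

open RotGraph

variable {n₀ m d₀ : ℕ} (e : Fin m → Fin n₀ × Fin n₀) (X : (k : ℕ) → RotGraph k d₀) (R : Fin m → ℕ → ℕ → Bool)
variable (W : ℕ) (y : Fin (m * 2) → ℕ)

/-! ### Claim 22.37 with per-cloud expansion, refined -/

/-- **(22.1) on a cloud, with expansion assumed only at the size of that cloud** (otherwise verbatim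
`DegreeReductionSoundness.mul_cloudBad_le_card_cloudViol`). [cite: AroraBarakCC2009, Claim 22.37 (proof, by (22.1))] -/
theorem mul_cloudBad_le_card_cloudViol' {η : ℝ} (hy : ∀ v, y v < W) (u : Fin n₀)
    (hX : ∀ Q : Finset (Fin (cloud e u).length), 2 * Q.card ≤ (cloud e u).length →
      η * Q.card ≤ ((univ.filter fun x : Fin (cloud e u).length × Fin d₀ =>
        x.1 ∈ Q ∧ (X (cloud e u).length).nbr x.1 x.2 ∉ Q).card : ℝ)) :
    η * cloudBad e W y u ≤ ((cloudViol e X y u).card : ℝ) := by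
  classical
  set k := (cloud e u).length
  set z := cloudPlur e W y u
  -- the bad positions split by value `a ∈ [W] \ {z}`
  have hbad : cloudBad e W y u = ∑ a ∈ (range W).erase z, classCard e y u a := by
    unfold cloudBad classCard
    rw [card_eq_sum_card_fiberwise (f := fun p => cval e y u p) (t := (range W).erase z) fun p hp =>
      mem_erase.2 ⟨(mem_filter.1 hp).2, mem_range.2 (hy _)⟩]
    refine sum_congr rfl fun b hb => ?_
    congr 1
    ext p
    simp only [mem_filter, mem_univ, true_and]
    constructor
    · rintro ⟨_, h⟩; exact h
    · intro h; exact ⟨fun hz => (mem_erase.1 hb).1 (h.symm.trans hz), h⟩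
  -- the darts leaving each class are violated, and these sets are disjoint
  have hle : ∑ a ∈ (range W).erase z, (univ.filter fun x : Fin k × Fin d₀ =>
      x.1 ∈ univ.filter (fun p => cval e y u p = a) ∧ (X k).nbr x.1 x.2 ∉ univ.filter (fun p => cval e y u p = a)).card ≤
      (cloudViol e X y u).card := by
    rw [← card_biUnion]
    · refine card_le_card fun x hx => ?_
      simp only [mem_biUnion, mem_filter, mem_univ, true_and, mem_erase] at hx
      obtain ⟨a, -, h1, h2⟩ := hx
      simp only [cloudViol, mem_filter, mem_univ, true_and]
      rw [h1]
      exact Ne.symm h2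
    · intro a _ a' _ hne
      simp only [Function.onFun]
      refine disjoint_filter.2 fun x _ h1 h2 => hne ?_
      simp only [mem_filter, mem_univ, true_and] at h1 h2
      exact h1.1.symm.trans h2.1
  have hexp : ∀ a ∈ (range W).erase z, η * classCard e y u a ≤
      ((univ.filter fun x : Fin k × Fin d₀ =>
        x.1 ∈ univ.filter (fun p => cval e y u p = a) ∧ (X k).nbr x.1 x.2 ∉ univ.filter (fun p => cval e y u p = a)).card : ℝ) :=
    fun a ha => by
      have h := hX _ (two_mul_classCard_le e W y hy u (mem_erase.1 ha).1)
      unfold classCard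
      exact h
  have hsumR : ∑ a ∈ (range W).erase z, ((univ.filter fun x : Fin k × Fin d₀ =>
      x.1 ∈ univ.filter (fun p => cval e y u p = a) ∧ (X k).nbr x.1 x.2 ∉ univ.filter (fun p => cval e y u p = a)).card : ℝ) ≤
      (cloudViol e X y u).card := by exact_mod_cast hle
  rw [hbad]
  push_cast
  rw [mul_sum]
  exact le_trans (sum_le_sum fun a ha => hexp a ha) hsumR

/-- **Claim 22.37, refined accounting.**  With per-cloud edge expansion `η ≥ 0` and values `< W` (`W ≥ 1`):
if every old assignment with values `< W` violates `≥ ε m` constraints, then for every `T`,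
`min(2(T+1), η) · ε m ≤ T · (2 · #bad constraints of y) + #violated darts of the reduced instance` —
the printed dichotomy "either many disagreements (violated equality darts) or the plurality assignment is
nearly `y` (violated constraint darts)", keeping the constraint darts with weight `T + 1`.
[cite: AroraBarakCC2009, Claim 22.37 (proof)] -/
theorem refined_soundness {η : ℝ} (hη : 0 ≤ η)
    (hX : ∀ (u : Fin n₀) (Q : Finset (Fin (cloud e u).length)), 2 * Q.card ≤ (cloud e u).length →
      η * Q.card ≤ ((univ.filter fun x : Fin (cloud e u).length × Fin d₀ =>
        x.1 ∈ Q ∧ (X (cloud e u).length).nbr x.1 x.2 ∉ Q).card : ℝ))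
    (hW : 0 < W) {ε : ℝ}
    (hε : ∀ σ : Fin n₀ → ℕ, (∀ u, σ u < W) → ε * m ≤ ((univ.filter fun s => R s (σ (e s).1) (σ (e s).2) = false).card : ℝ))
    (hy : ∀ v, y v < W) (T : ℕ) :
    min (2 * ((T : ℝ) + 1)) η * (ε * m) ≤ (T : ℝ) * (2 * (badCons R y).card) + (violatedDarts e X R y).card := by
  classical
  set τ : ℝ := ((∑ u, cloudBad e W y u : ℕ) : ℝ) with hτ
  set By : ℝ := ((badCons R y).card : ℝ) with hBy
  have hτ0 : 0 ≤ τ := Nat.cast_nonneg _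
  have hBy0 : 0 ≤ By := Nat.cast_nonneg _
  -- the plurality assignment is a legitimate old assignment
  have hz := hε (fun u => cloudPlur e W y u) (cloudPlur_lt e W y hW)
  have hBz : ε * m ≤ By + τ := by
    have := card_badCons_plur_le e R W y
    have h' : ((univ.filter fun s => R s (cloudPlur e W y (e s).1) (cloudPlur e W y (e s).2) = false).card : ℝ) ≤
        (badCons R y).card + ((∑ u, cloudBad e W y u : ℕ) : ℝ) := by exact_mod_cast this
    linarith
  -- the violated darts
  have hviol : (2 : ℝ) * By + η * τ ≤ (violatedDarts e X R y).card := by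
    rw [card_violated_eq, hτ]
    push_cast
    have hsum : η * ∑ u, (cloudBad e W y u : ℝ) ≤ ∑ u, ((cloudViol e X y u).card : ℝ) := by
      rw [mul_sum]
      exact sum_le_sum fun u _ => mul_cloudBad_le_card_cloudViol' e X W y hy u (hX u)
    linarith
  have hmin2 : min (2 * ((T : ℝ) + 1)) η ≤ 2 * ((T : ℝ) + 1) := min_le_left _ _
  have hminc : min (2 * ((T : ℝ) + 1)) η ≤ η := min_le_right _ _
  have hmin0 : 0 ≤ min (2 * ((T : ℝ) + 1)) η := le_min (by positivity) hη
  calc min (2 * ((T : ℝ) + 1)) η * (ε * m) ≤ min (2 * ((T : ℝ) + 1)) η * (By + τ) := mul_le_mul_of_nonneg_left hBz hmin0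
    _ = min (2 * ((T : ℝ) + 1)) η * By + min (2 * ((T : ℝ) + 1)) η * τ := by ring
    _ ≤ 2 * ((T : ℝ) + 1) * By + η * τ := add_le_add (mul_le_mul_of_nonneg_right hmin2 hBy0) (mul_le_mul_of_nonneg_right hminc hτ0)
    _ = (T : ℝ) * (2 * By) + (2 * By + η * τ) := by ring
    _ ≤ _ := by linarith

/-! ### The one-shot degree reduction -/

/-- The trivial cloud graphs of degree `0` (so that `reduced e X₀` is the bare constraint matching). [folklore] -/
def X₀ (k : ℕ) : RotGraph k 0 := ⟨id, fun _ => rfl⟩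

/-- With no expander darts there are no violated equality darts. [folklore] -/
theorem card_cloudViol_X₀ (u : Fin n₀) : (cloudViol e X₀ y u).card = 0 := by
  rw [card_eq_zero]
  ext ⟨p, j⟩
  exact j.elim0

/-- The violated darts of the bare matching are twice the bad constraints. [cite: AroraBarakCC2009, Claim 22.37 (proof, accounting)] -/
theorem card_violatedDarts_X₀ : (violatedDarts e X₀ R y).card = 2 * (badCons R y).card := by
  rw [card_violated_eq]
  simp [card_cloudViol_X₀]

/-- A cloud has at most `2m` members (it is a sublist of the `2m` occurrences). [folklore] -/
theorem length_cloud_le (u : Fin n₀) : (cloud e u).length ≤ m * 2 := by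
  unfold cloud
  refine (List.length_filter_le _ _).trans ?_
  unfold occList
  simp [List.length_product]

/-- **The one-shot reduced graph**: on the `2m` occurrences, the constraint matching thickened `2m` times,
united with the cloud graph whose clouds carry complete graphs of uniform degree `2m`.
[cite: AroraBarakCC2009, Claim 22.37 (the construction, with complete graphs as cloud expanders)] -/
def osGraph : RotGraph (m * 2) (1 * (m * 2) + (m * 2 + 1)) :=
  ((reduced e X₀).thick (m * 2)).union (reduced e fun k => cc k (m * 2))

/-- The dart constraints of `osGraph`. [cite: AroraBarakCC2009, Claim 22.37] -/
def osC : Fin (m * 2) → Fin (1 * (m * 2) + (m * 2 + 1)) → ℕ → ℕ → Bool :=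
  unionC (thickC (reducedC (d₀ := 0) R) (m * 2)) (reducedC (d₀ := m * 2) R)

/-- **Completeness of the one-shot degree reduction**: the lift of an assignment satisfying every constraint
satisfies every dart. [cite: AroraBarakCC2009, Claim 22.37 (completeness)] -/
theorem osC_lift {σ : Fin n₀ → ℕ} (hσ : ∀ s, R s (σ (e s).1) (σ (e s).2) = true) (v : Fin (m * 2))
    (i : Fin (1 * (m * 2) + (m * 2 + 1))) : osC R v i (liftOcc e σ v) (liftOcc e σ ((osGraph e).nbr v i)) = true :=
  unionC_of_forall (thickC_of_forall (m * 2) fun v i => reducedC_lift e X₀ R hσ v i) (fun v i => reducedC_lift e _ R hσ v i) v i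

/-- The violated darts of `osGraph` under `y`: `2m · 2#bad + #violated(reduced with complete clouds)`. [folklore] -/
theorem violN_os : violN (osGraph e) (osC R) y =
    2 * (badCons R y).card * (m * 2) + (violatedDarts e (fun k => cc k (m * 2)) R y).card := by
  unfold osGraph osC
  rw [violN_union, violN_thick]
  congr 1
  rw [← card_violatedDarts_X₀ e R y]
  rfl

/-- **Soundness of the one-shot degree reduction**: if every assignment with values `< W` (`W ≥ 1`) violates at
least `ε m` of the `m` constraints, every assignment `y` with values `< W` violates at least `(m/2) · ε m`
darts of `(osGraph, osC)` (out of `2m (4m + 1)`). [cite: AroraBarakCC2009, Claim 22.37 (soundness)] -/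
theorem os_soundness (hW : 0 < W) {ε : ℝ}
    (hε : ∀ σ : Fin n₀ → ℕ, (∀ u, σ u < W) → ε * m ≤ ((univ.filter fun s => R s (σ (e s).1) (σ (e s).2) = false).card : ℝ))
    (hy : ∀ v, y v < W) : ((m : ℝ) / 2) * (ε * m) ≤ (violN (osGraph e) (osC R) y : ℝ) := by
  have hη : (0 : ℝ) ≤ ((m * 2 : ℕ) : ℝ) / 4 := by positivity
  have hX : ∀ (u : Fin n₀) (Q : Finset (Fin (cloud e u).length)), 2 * Q.card ≤ (cloud e u).length →
      ((m * 2 : ℕ) : ℝ) / 4 * Q.card ≤ ((univ.filter fun x : Fin (cloud e u).length × Fin (m * 2) =>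
        x.1 ∈ Q ∧ ((fun k => cc k (m * 2)) (cloud e u).length).nbr x.1 x.2 ∉ Q).card : ℝ) := by
    intro u Q hQ
    rcases Nat.eq_zero_or_pos (cloud e u).length with h0 | hpos
    · have hQ0 : Q.card = 0 := by
        rw [card_eq_zero]; ext p; have := p.isLt; lia
      rw [hQ0, Nat.cast_zero, mul_zero]
      exact Nat.cast_nonneg _
    · exact cc_edgeExpansion hpos (length_cloud_le e u) Q hQ
  have h := refined_soundness e (fun k => cc k (m * 2)) R W y hη hX hW hε hy (m * 2)
  rw [violN_os]
  push_cast at h ⊢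
  have hmin : (m : ℝ) / 2 ≤ min (2 * ((m : ℝ) * 2 + 1)) ((m : ℝ) * 2 / 4) := by
    refine le_min (by nlinarith [Nat.cast_nonneg (α := ℝ) m]) (by linarith)
  have hεm : 0 ≤ ε * m ∨ ε * m < 0 := le_or_gt 0 _
  rcases hεm with hεm | hεm
  · calc (m : ℝ) / 2 * (ε * m) ≤ min (2 * ((m : ℝ) * 2 + 1)) ((m : ℝ) * 2 / 4) * (ε * m) := mul_le_mul_of_nonneg_right hmin hεm
      _ ≤ _ := by linarith
  · have : (m : ℝ) / 2 * (ε * m) ≤ 0 := mul_nonpos_of_nonneg_of_nonpos (by positivity) hεm.le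
    exact this.trans (by positivity)

/-! ### The one-shot expanderization -/

/-- The degree of `osGraph`. [folklore] -/
abbrev osD (m : ℕ) : ℕ := 1 * (m * 2) + (m * 2 + 1)

/-- **The one-shot expanderized graph**: `osGraph` thickened `2m` times, united with the complete graph on the
`2m` occurrences thickened to the same degree. [cite: AroraBarakCC2009, Claim 22.38 (the construction, with the complete graph as the expander)] -/
def exGraph : RotGraph (m * 2) (osD m * (m * 2) + (m * 2) * osD m) :=
  ((osGraph e).thick (m * 2)).union ((cc (m * 2) (m * 2)).thick (osD m))

/-- The dart constraints of `exGraph`: those of `osGraph` on the first half, always-true on the complete half.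
[cite: AroraBarakCC2009, Claim 22.38 ("null constraints")] -/
def exC : Fin (m * 2) → Fin (osD m * (m * 2) + (m * 2) * osD m) → ℕ → ℕ → Bool :=
  unionC (thickC (osC R) (m * 2)) fun _ _ _ _ => true

/-- **Completeness of the one-shot preprocessing.** [cite: AroraBarakCC2009, Claims 22.37–22.38 (completeness)] -/
theorem exC_lift {σ : Fin n₀ → ℕ} (hσ : ∀ s, R s (σ (e s).1) (σ (e s).2) = true) (v : Fin (m * 2))
    (i : Fin (osD m * (m * 2) + (m * 2) * osD m)) : exC R v i (liftOcc e σ v) (liftOcc e σ ((exGraph e).nbr v i)) = true :=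
  unionC_of_forall (thickC_of_forall (m * 2) fun v i => osC_lift e R hσ v i) (fun _ _ => rfl) v i

/-- The violated darts of `exGraph` are `2m` times those of `osGraph`. [folklore] -/
theorem violN_ex : violN (exGraph e) (exC R) y = violN (osGraph e) (osC R) y * (m * 2) := by
  unfold exGraph exC
  rw [violN_union, violN_thick]
  have h0 : violN ((cc (m * 2) (m * 2)).thick (osD m)) (fun _ _ _ _ => true) y = 0 := by
    rw [violN_eq_sum]
    simp
  rw [h0, add_zero]

/-- **Soundness of the one-shot preprocessing, in the form consumed by the dart game**: if every assignment
with values `< W` (`W ≥ 1`) violates at least `ε m` constraints (`0 ≤ ε`), then every assignment with values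
`< W` violates at least an `ε/40`-fraction of the `n · d` darts of `(exGraph, exC)`.
[cite: AroraBarakCC2009, Claims 22.37–22.38 (soundness)] -/
theorem ex_soundness (hW : 0 < W) {ε : ℝ} (hε0 : 0 ≤ ε)
    (hε : ∀ σ : Fin n₀ → ℕ, (∀ u, σ u < W) → ε * m ≤ ((univ.filter fun s => R s (σ (e s).1) (σ (e s).2) = false).card : ℝ))
    (hy : ∀ v, y v < W) :
    ε / 40 * (((m * 2 : ℕ) : ℝ) * ((osD m * (m * 2) + (m * 2) * osD m : ℕ) : ℝ)) ≤ (violN (exGraph e) (exC R) y : ℝ) := by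
  rw [violN_ex]
  have h := os_soundness e R W y hW hε hy
  push_cast at h ⊢
  rcases Nat.eq_zero_or_pos m with hm0 | hm1
  · subst hm0
    simp
  have hm : (1 : ℝ) ≤ m := by exact_mod_cast hm1
  -- `ε/40 · 2m · (2 · (2m + 2m+1) · 2m) = ε m² (4m+1)/5 ≤ ε m³ = (m/2) ε m · 2m` for `m ≥ 1`
  have key : ε / 40 * ((m : ℝ) * 2 * ((1 * ((m : ℝ) * 2) + ((m : ℝ) * 2 + 1)) * ((m : ℝ) * 2) + (m : ℝ) * 2 * (1 * ((m : ℝ) * 2) + ((m : ℝ) * 2 + 1)))) ≤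
      (m : ℝ) / 2 * (ε * m) * ((m : ℝ) * 2) := by
    have h1 : 0 ≤ ε * ((m : ℝ) * m) * ((m : ℝ) - 1) := mul_nonneg (mul_nonneg hε0 (by positivity)) (sub_nonneg.2 hm)
    nlinarith [h1]
  exact key.trans (mul_le_mul_of_nonneg_right h (by positivity))

/-- **The one-shot expanderized graph is a `1/2`-spectral expander** (`m ≥ 1`): half of its labels form the
complete graph (`λ = 0`), the other half a regular graph (`λ ≤ 1`). [cite: AroraBarakCC2009, Claim 22.38 (proof, subadditivity of λ) and Exercise 21.7] -/
theorem ex_spectral (hm : 0 < m) : SpectralBound (exGraph e).walkMatrix (1 / 2) := by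
  have hD : 0 < osD m := by unfold osD; positivity
  have hm2 : 0 < m * 2 := by positivity
  have h₁ : 0 < osD m * (m * 2) := Nat.mul_pos hD hm2
  have h₂ : 0 < (m * 2) * osD m := Nat.mul_pos hm2 hD
  have hG : SpectralBound ((osGraph e).thick (m * 2)).walkMatrix 1 := spectralBound_one (isWalkMatrix_walkMatrix _ h₁)
  have hH : SpectralBound ((cc (m * 2) (m * 2)).thick (osD m)).walkMatrix 0 := by
    rw [walkMatrix_thick _ hD]
    exact spectralBound_cc_self (m * 2)
  have h := spectralBound_union _ _ h₁ h₂ hG hH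
  refine SpectralBound.mono h (le_of_eq ?_)
  rw [mul_zero, add_zero, mul_one]
  have hpos : (0 : ℝ) < ((osD m * (m * 2) : ℕ) : ℝ) + ((m * 2 * osD m : ℕ) : ℝ) := by positivity
  rw [div_eq_iff hpos.ne']
  push_cast
  ring

end DegreeReduction

end Expander

end Literature.Computability.Complexity
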